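import Mathlib

/-!
# Federbush, *A phase cell approach to Yang–Mills theory. IV. The choice of variables* (CMP **114** (1988) 317–343) —
# Appendix A «Geometric Constructions»: THEOREMS A.1–A.4 as TYPED STATEMENTS with citation tags, the Lipschitz constant
# `Λ₁` of (11.4), and the two Euclidean extension steps (A.3)–(A.8) of the proof of Theorem A.1 PROVED (McShane)

statement-level skeleton of published theorems with citation tags; proofs where landed; nothing here is a claim about the Yang–Mills mass gap

Cell `lit-balaban`, reader/typer block **r19** (F4 fold owner); SKELETON rows `F4.ThmA.1`, `F4.ThmA.2`, `F4.ThmA.3`, `F4.ThmA.4`,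
`F4.Eq11.4` (+ the D-rows `F4.EqA.17`, `F4.EqA.27-A.29`) of `run/shared/lean/pub/lit-balaban/lit-balaban-r19/ROWS-F4.md`;
PHASE2-TARGETS.md §A names this file.

**Source.** P. Federbush, Commun. Math. Phys. **114** (1988) 317–343 [bib `Federbush1988PhaseCellIV`; doi:10.1007/bf01225039;
lit store `paper:doi-10-1007-bf01225039` (text layer); journal page = PDF page + 316].  Pages READ AS IMAGES by this seat
(poppler ×2.4 renders of the byte-identical Deep-Blue/Wayback scan, sha256 `d1b02f02…1bf380` = the store's holding):
p. 337 [PDF 21] ((11.2)–(11.6), Geometric Constructions 1–2, the definition of `Λ₁`), p. 338 [22] ((11.7)–(11.12)), p. 339 [23]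
(Appendix A part A, Theorem A.1, (A.1)–(A.3)), p. 340 [24] ((A.4)–(A.13)), p. 341 [25] ((A.14)–(A.24), part B, Theorem A.2),
p. 342 [26] (part C, Theorem A.3, (A.25)–(A.33)), p. 343 [27] (Theorem A.4, (A.34)–(A.38), references) — renders
`run/shared/lean/pub/lit-balaban/lit-balaban-r19/renders/f4/f4-p021…p027.png`.

**Why in the corpus.** F4 is the Federbush-series paper that cites Bałaban's averaging («The block spin transformation of Bałaban
in the small field region [1, Eq. (1.8)]», p. 318, [1] = CMP 95/96); its §11 gauge interpolation (Geometric Constructions 1–6)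
rests on the four geometric theorems of Appendix A («Caution. The geometric theorems of Appendix A, require a universal bound on
`Λ₁` of `φ`'s (as scaled to unit scale)», p. 339).  No statement of F4 is cited by the Bałaban papers or by the T⁴ spine
(INTERFACES.md §1.5); the rows are typed because they are the paper's only numbered statements (PHASE2-TARGETS §A).

**What is typed, and how.**
* `Λ₁` (11.4) p. 337 («`Λ₁(φ) = Sup_{x,y} d(φ(x), φ(y))/|x − y|`») is the `ℝ≥0∞`-valued supremum `lipConst` of the difference
  quotients of a map between (extended pseudo-)metric spaces; `lipConst_le_iff` PROVES `Λ₁(φ) ≤ K ↔ LipschitzWith K φ`, so every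
  printed inequality `Λ₁(·) ≤ …` below is literally an inequality in `ℝ≥0∞` (value `∞` for a non-Lipschitz map, where print's
  bounds are vacuous too).  `d^M(g₁, g₂) = sup_x d(g₁(x), g₂(x))` (A.17) is `supDist`, same type.
* The domains: `D = {0 ≤ x_i ≤ 1}` the unit `n`-cube of `ℝⁿ` with the EUCLIDEAN distance `|x − y|` (`unitCube n ⊆ EuclideanSpace ℝ
  (Fin n)`, `cubeBoundary n = frontier`, `cubeBoundary_subset` PROVED), `B` the closed unit ball, `∂B` the unit sphere
  (`Metric.closedBall/sphere`); maps «from `∂D` into `M`» are functions on the subtypes, so `Λ₁` sees the restricted metric.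
* Theorems A.1/A.2 (parts A, B: «Let `M` be a compact differentiable manifold (without boundary) and provided with a Riemannian
  metric» p. 339 / «supplied with a metric» p. 341; the proof of A.2 moves «along the shortest geodesic in `M`» (A.22)): `M` is a
  type carrying Mathlib's standard `C^∞` RIEMANNIAN-MANIFOLD context (`IsManifold I ∞ M`, `Bundle.RiemannianBundle`,
  `IsContMDiffRiemannianBundle`, `IsRiemannianManifold I M` = "the distance is the infimum of path lengths"), `CompactSpace M`,
  `BoundarylessManifold I M`; «homotopically trivial mapping» = `ContinuousMap.Nullhomotopic`.  The statements `ThmA1`, `ThmA2`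
  are `Prop`-valued definitions over that context (NOT asserted); the printed remark after (A.2) («We do not know if the
  limitation in (A.1) is necessary, whether there may not be a universal `c₂`») is quoted, not typed.
* Theorems A.3/A.4 (parts C, D) bound COORDINATE derivatives: print embeds `M` in a Euclidean space («We now embed `M` in some
  Euclidean space `R^t`, and view `f` as a map from `B` into `R^t`», p. 342) and measures derivatives in «any reasonable `L_∞`
  norm» (p. 338, after (11.11)).  Accordingly `ThmA3`/`ThmA4` take the target as a SET `M ⊆ EuclideanSpace ℝ (Fin t)` (its
  printed standing hypothesis — compact differentiable submanifold without boundary — is the hypothesis under which print asserts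
  the `Prop`, i.e. the hypothesis of a future `…_holds`, and is not a field of the statement), `f^s`, `f^{es}` are ambient maps
  `ℝⁿ → R^t` with values in `M` on the (punctured) ball, smooth on the open (punctured) ball (print differentiates them), and
  `|D^α f(x)| ≤ …` for the multi-indices of order `|α| = m` is `‖iteratedFDeriv ℝ m f x‖ ≤ …` for every `m ≥ 1` (READING: the
  printed exponent `(d(x, ∂B))^{−(|α|−1)}` is a derivative bound, `|α| ≥ 1`; at `|α| = 0` it would bound `|f^s(x)|` by
  `d(x, ∂B) Λ₁(f)`, which is not meant); `Λ₁(f)` enters through `∀ K, LipschitzWith K f → … ≤ c_m · … · K` (equivalent to the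
  `Λ₁` form by `lipConst_le_iff`), with `f`'s Lipschitz constant measured in the ambient metric of `R^t` restricted to `M`
  (print's `d` after the embedding; bi-Lipschitz to the intrinsic distance on a compact submanifold — constants `c_α` absorb it).
  The constants `c_α` are independent of `f` (else (A.26) is empty): `∃ c : ℕ → ℝ` outside `∀ f`.
* PROVED (the Euclidean core of the proof of Theorem A.1, p. 340): (A.6)–(A.8) «In fact we can choose the `c` of (A.8) to be 1!
  This is a well-known extension theorem» = McShane's extension (`LipschitzOnWith.extend_real`) followed by the 1-Lipschitz clamp
  to `[a, b]` (`extend_real_Icc`); (A.3)–(A.5) with `c(s) = (card (Fin s))^{1/2} = √s` for the Euclidean norm of `R^s`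
  (coordinatewise McShane, `extend_euclidean`), together with «Moreover if the image of `f` lies in a cube, `f^e` can be chosen so
  that the image of `f^e` lies in the same cube» (`extend_euclidean_box`).  Also PROVED: the smoothing function of (A.27) EXISTS
  (`exists_smoothingFunction`, from Mathlib's `ContDiffBump`).  The simplicial steps 1)–4) (A.9)–(A.16) («we hold these truths
  to be self-evident», p. 340) and Theorems A.1–A.4 themselves are NOT proved here.
* v1.1 (§8, append-only): the regularized distances of (A.29) and (A.37) EXIST — `exists_regularizedDist_ball` (`d(x) = ½(1 − |x|²)` on
  the open unit ball, `n ≥ 1`) and `exists_regularizedDist_puncturedBall` (`d′(x) = |x − x₀|(1 − |x − x₀|)` on the punctured ball) are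
  PROVED, with the distance-to-the-sphere bounds `infDist_sphere_le` / `le_infDist_sphere` (`d(x, ∂B) = 1 − |x − x₀|` on `B`).
-/

namespace Literature.MathematicalPhysics.QuantumFieldTheory.Federbush1986

noncomputable section

open scoped NNReal ENNReal ContDiff Manifold
open Set Metric Bundle

namespace PhaseCellIVAppA

/-! ## 1. The Lipschitz constant `Λ₁` of (11.4) and the sup-distance `d^M` of (A.17) -/

/-- «`Λ₁(φ) = Sup_{x,y} d(φ(x), φ(y)) / |x − y|`» (p. 337, after (11.4); Appendix A p. 339: «Define `Λ₁` as defined after (11.4),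
on any mapping from a subset of `D` into `M`») — the Lipschitz constant of a map `φ` between (extended pseudo-)metric spaces, as
an element of `ℝ≥0∞` (the pair `x = y` contributes `0/0 = 0`; the value is `∞` exactly when `φ` admits no Lipschitz constant,
cf. `lipConst_le_iff`). [cite: Federbush1988PhaseCellIV, (11.4) p. 337; Appendix A p. 339] -/
def lipConst {X Y : Type*} [PseudoEMetricSpace X] [PseudoEMetricSpace Y] (φ : X → Y) : ℝ≥0∞ :=
  ⨆ (x : X) (y : X), edist (φ x) (φ y) / edist x y

/-- `Λ₁(φ) ≤ K` is exactly `K`-Lipschitz continuity of `φ` (source a pseudo-METRIC space, so that `|x − y| < ∞`): the bridge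
between the printed inequalities on `Λ₁` and Mathlib's `LipschitzWith`. [cite: Federbush1988PhaseCellIV, (11.4) p. 337] -/
theorem lipConst_le_iff {X Y : Type*} [PseudoMetricSpace X] [PseudoEMetricSpace Y] {φ : X → Y} {K : ℝ≥0} :
    lipConst φ ≤ K ↔ LipschitzWith K φ := by
  simp only [lipConst, iSup_le_iff]
  refine forall₂_congr fun x y => ?_
  rw [ENNReal.div_le_iff_le_mul (Or.inr ENNReal.coe_ne_top) (Or.inl (edist_ne_top x y))]

/-- A `K`-Lipschitz map has `Λ₁ ≤ K`. [cite: Federbush1988PhaseCellIV, (11.4) p. 337] -/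
theorem lipConst_le_of_lipschitzWith {X Y : Type*} [PseudoMetricSpace X] [PseudoEMetricSpace Y] {φ : X → Y} {K : ℝ≥0}
    (h : LipschitzWith K φ) : lipConst φ ≤ K :=
  lipConst_le_iff.mpr h

/-- (A.17) p. 341: «Given two maps `g₁` and `g₂` into `M` we define `d^M(g₁, g₂) = sup_x d(g₁(x), g₂(x))`» (in `ℝ≥0∞`, like `Λ₁`).
[cite: Federbush1988PhaseCellIV, (A.17) p. 341] -/
def supDist {X Y : Type*} [PseudoEMetricSpace Y] (g₁ g₂ : X → Y) : ℝ≥0∞ := ⨆ x, edist (g₁ x) (g₂ x)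

/-- Each pointwise distance is bounded by `d^M`. [cite: Federbush1988PhaseCellIV, (A.17) p. 341] -/
theorem edist_le_supDist {X Y : Type*} [PseudoEMetricSpace Y] (g₁ g₂ : X → Y) (x : X) :
    edist (g₁ x) (g₂ x) ≤ supDist g₁ g₂ :=
  le_iSup (fun x => edist (g₁ x) (g₂ x)) x

/-! ## 2. The domains: the unit `n`-cube `D`, its boundary `∂D`; the unit ball `B` and sphere `∂B` are Mathlib's -/

/-- «Let `D` be the unit `n`-cube, `D = {0 ≤ x_i ≤ 1}`» (p. 339), inside `ℝⁿ` with its Euclidean distance `|x − y|`.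
[cite: Federbush1988PhaseCellIV, Appendix A p. 339] -/
def unitCube (n : ℕ) : Set (EuclideanSpace ℝ (Fin n)) := {x | ∀ i, x i ∈ Icc (0 : ℝ) 1}

/-- `D` is closed. [cite: Federbush1988PhaseCellIV, Appendix A p. 339] -/
theorem isClosed_unitCube (n : ℕ) : IsClosed (unitCube n) := by
  have : unitCube n = ⋂ i, (fun x : EuclideanSpace ℝ (Fin n) => x i) ⁻¹' Icc (0 : ℝ) 1 := by
    ext x; simp [unitCube]
  rw [this]
  exact isClosed_iInter fun i => isClosed_Icc.preimage (by fun_prop)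

/-- `∂D`, the boundary of the unit cube (the domain of the maps `f` of Theorem A.1: «mapping from `∂D` into `M`»).
[cite: Federbush1988PhaseCellIV, Theorem A.1 p. 339] -/
def cubeBoundary (n : ℕ) : Set (EuclideanSpace ℝ (Fin n)) := frontier (unitCube n)

/-- `∂D ⊆ D` (so that «an extension of `f`, `f^e`, mapping `D` into `M`» makes sense). [cite: Federbush1988PhaseCellIV, Theorem A.1 p. 339] -/
theorem cubeBoundary_subset (n : ℕ) : cubeBoundary n ⊆ unitCube n :=
  frontier_subset_closure.trans (isClosed_unitCube n).closure_subset

/-! ## 3. Theorem A.1 (Appendix A, part A «Geometric Constructions 1 and 3», p. 339) -/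

/-- **Theorem A.1** p. 339, verbatim: «Let `M` be a compact differentiable manifold (without boundary) and provided with a
Riemannian metric. Let `D` be the unit `n`-cube … *For each constant `c₁`, there is a constant `c₂ = c₂(c₁)`, such that if `f` is
any homotopically trivial mapping from `∂D` into `M` satisfying `Λ₁(f) ≤ c₁` (A.1) there is an extension of `f`, `f^e`, mapping
`D` into `M`, satisfying `Λ₁(f^e) ≤ c₂ Λ₁(f)` (A.2).*»  Printed remark: «We do not know if the limitation in (A.1) is necessary,
whether there may not be a universal `c₂`.»  TYPING: `M` carries Mathlib's `C^∞` Riemannian-manifold context (model `I`,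
`IsRiemannianManifold I M`: the distance `d` of `Λ₁` is the Riemannian one), compact and boundaryless; «homotopically trivial» =
`ContinuousMap.Nullhomotopic`; `f^e` extends `f` along `cubeBoundary_subset`; (A.1), (A.2) are inequalities in `ℝ≥0∞`
(`lipConst`).  A `Prop`-valued definition: NOT asserted here (the printed proof, pp. 339–341, reduces to (A.3)–(A.8) — proved
below — and to the simplicial statements 1)–4), (A.9)–(A.16), «we hold these truths to be self-evident»).
[cite: Federbush1988PhaseCellIV, Theorem A.1 (A.1)–(A.2) p. 339] -/
def ThmA1 (n : ℕ) {E : Type*} [NormedAddCommGroup E] [NormedSpace ℝ E] {H : Type*} [TopologicalSpace H]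
    (I : ModelWithCorners ℝ E H) (M : Type*) [EMetricSpace M] [ChartedSpace H M] [IsManifold I ∞ M]
    [RiemannianBundle (fun (x : M) ↦ TangentSpace I x)]
    [IsContMDiffRiemannianBundle I ∞ E (fun (x : M) ↦ TangentSpace I x)]
    [IsRiemannianManifold I M] [CompactSpace M] [BoundarylessManifold I M] : Prop :=
  ∀ c₁ : ℝ≥0, ∃ c₂ : ℝ≥0, ∀ f : C(↥(cubeBoundary n), M), f.Nullhomotopic → lipConst f ≤ c₁ →
    ∃ fe : ↥(unitCube n) → M,
      (∀ x : ↥(cubeBoundary n), fe ⟨x.1, cubeBoundary_subset n x.2⟩ = f x) ∧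
      lipConst fe ≤ c₂ * lipConst f

/-! ## 4. The Euclidean extension steps (A.3)–(A.8) of the proof of Theorem A.1 (p. 340) — PROVED -/

/-- (A.6)–(A.8) p. 340: «We are reduced to proving that there is a `c` such that if `f : ∂D → [a, b]` (A.6), there is an extension
of `f`, `f^e : D → [a, b]` (A.7), such that `Λ₁(f^e) ≤ c Λ₁(f)` (A.8). In fact we can choose the `c` of (A.8) to be 1! This is a
well-known extension theorem.»  PROVED for an arbitrary subset `S` of a pseudo-metric space in place of `∂D ⊆ D` (McShane's
extension `LipschitzOnWith.extend_real`, then the 1-Lipschitz clamp `max(min(b, ·), a)` into `[a, b]`): same constant `K`.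
[cite: Federbush1988PhaseCellIV, (A.6)–(A.8) p. 340] -/
theorem extend_real_Icc {X : Type*} [PseudoMetricSpace X] {S : Set X} {a b : ℝ} (hab : a ≤ b)
    {f : X → ℝ} {K : ℝ≥0} (hf : LipschitzOnWith K f S) (hrange : MapsTo f S (Icc a b)) :
    ∃ g : X → ℝ, LipschitzWith K g ∧ EqOn f g S ∧ ∀ x, g x ∈ Icc a b := by
  obtain ⟨g, hg, hfg⟩ := hf.extend_real
  refine ⟨fun x => max (min b (g x)) a, (hg.const_min b).max_const a, fun x hx => ?_, fun x => ?_⟩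
  · have h1 := hrange hx
    simp only
    rw [← hfg hx, min_eq_right h1.2, max_eq_left h1.1]
  · exact ⟨le_max_right _ _, max_le (min_le_left _ _) hab⟩

/-- (A.3)–(A.5) p. 339–340: «if `f : ∂D → R^s` (A.3), then there is an extension `f^e : D → R^s` (A.4) satisfying
`Λ₁(f^e) ≤ c(s) Λ₁(f)` (A.5)» («We choose axes in `R^s` … It is enough that we carry out the extension for each component of the
mapping separately»).  PROVED, for an arbitrary subset `S` of a pseudo-metric space, with the explicit constant
`c(s) = (card (Fin s))^{1/2} = √s` for the EUCLIDEAN norm of `R^s` (each coordinate is extended with its own constant by McShane;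
the factor `√s` is the price of reassembling the coordinates in the `ℓ²` norm — Mathlib's `PiLp.lipschitzWith_toLp`).
[cite: Federbush1988PhaseCellIV, (A.3)–(A.5) pp. 339–340] -/
theorem extend_euclidean {X : Type*} [PseudoMetricSpace X] {S : Set X} {s : ℕ}
    {f : X → EuclideanSpace ℝ (Fin s)} {K : ℝ≥0} (hf : LipschitzOnWith K f S) :
    ∃ g : X → EuclideanSpace ℝ (Fin s),
      LipschitzWith ((Fintype.card (Fin s) : ℝ≥0) ^ (1 / (2 : ℝ≥0∞)).toReal * K) g ∧ EqOn f g S := by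
  have hF : LipschitzOnWith K (WithLp.ofLp ∘ f) S := by
    simpa using (PiLp.lipschitzWith_ofLp 2 (fun _ : Fin s => ℝ)).comp_lipschitzOnWith hf
  obtain ⟨G, hG, hGeq⟩ := hF.extend_pi
  refine ⟨fun x => WithLp.toLp 2 (G x), (PiLp.lipschitzWith_toLp 2 (fun _ : Fin s => ℝ)).comp hG, ?_⟩
  intro x hx
  have h1 : WithLp.ofLp (f x) = G x := hGeq hx
  show f x = WithLp.toLp 2 (G x)
  rw [← h1]

/-- p. 340, the sentence after (A.5): «Moreover if the image of `f` lies in a cube, `f^e` can be chosen so that the image of `f^e`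
lies in the same cube.»  PROVED (coordinatewise `extend_real_Icc`; same constant as `extend_euclidean`), the cube being the box
`∏_i [a_i, b_i]` with axes parallel to those of `R^s` («We choose axes in `R^s` parallel to the edges of the cube»).
[cite: Federbush1988PhaseCellIV, (A.5) p. 340] -/
theorem extend_euclidean_box {X : Type*} [PseudoMetricSpace X] {S : Set X} {s : ℕ}
    {f : X → EuclideanSpace ℝ (Fin s)} {K : ℝ≥0} (hf : LipschitzOnWith K f S)
    {a b : Fin s → ℝ} (hab : ∀ i, a i ≤ b i) (hbox : ∀ x ∈ S, ∀ i, f x i ∈ Icc (a i) (b i)) :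
    ∃ g : X → EuclideanSpace ℝ (Fin s),
      LipschitzWith ((Fintype.card (Fin s) : ℝ≥0) ^ (1 / (2 : ℝ≥0∞)).toReal * K) g ∧ EqOn f g S ∧
      ∀ x i, g x i ∈ Icc (a i) (b i) := by
  have hF : LipschitzOnWith K (WithLp.ofLp ∘ f) S := by
    simpa using (PiLp.lipschitzWith_ofLp 2 (fun _ : Fin s => ℝ)).comp_lipschitzOnWith hf
  have hi : ∀ i, ∃ g : X → ℝ, LipschitzWith K g ∧ EqOn (fun x => f x i) g S ∧ ∀ x, g x ∈ Icc (a i) (b i) := by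
    intro i
    have hFi : LipschitzOnWith K (fun x => f x i) S :=
      LipschitzOnWith.of_dist_le_mul fun x hx y hy =>
        (dist_le_pi_dist (WithLp.ofLp (f x)) (WithLp.ofLp (f y)) i).trans (hF.dist_le_mul x hx y hy)
    exact extend_real_Icc (hab i) hFi (fun x hx => hbox x hx i)
  choose g hg hfg hgbox using hi
  have hG : LipschitzWith K (fun x i => g i x) :=
    LipschitzWith.of_dist_le_mul fun x y =>
      (dist_pi_le_iff (mul_nonneg K.2 dist_nonneg)).2 fun i => (hg i).dist_le_mul x y
  refine ⟨fun x => WithLp.toLp 2 (fun i => g i x), (PiLp.lipschitzWith_toLp 2 (fun _ : Fin s => ℝ)).comp hG, ?_, ?_⟩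
  · intro x hx
    have h1 : WithLp.ofLp (f x) = fun i => g i x := funext fun i => hfg i hx
    show f x = WithLp.toLp 2 (fun i => g i x)
    rw [← h1]
  · intro x i
    exact hgbox i x

/-! ## 5. Theorem A.2 (Appendix A, part B «Geometric Constructions 2 and 4», p. 341) -/

/-- **Theorem A.2** p. 341, verbatim: «Let `M` be a compact differentiable manifold (without boundary) and supplied with a metric.
… With `B` the unit ball, we have given three maps `f₁ : ∂B → M`, `f₂ : ∂B → M`, `f₁^e : B → M`, where `f₁^e` is an extension of
`f₁`. *If `d^M(f₁, f₂) ≤ ε_M`, with `ε_M` an absolute constant independent of the three maps, then there is an extension `f₂^e`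
of `f₂` to the ball satisfying `d^M(f₁^e, f₂^e) ≤ c₁ d^M(f₁, f₂)` (A.18), `Λ₁(f₂^e) ≤ c₂[Λ₁(f₁^e) + d^M(f₁, f₂) + Λ₁(f₂)]` (A.19),
for some absolute constants `c₁` and `c₂`.*»  TYPING: same manifold context as `ThmA1` (the construction runs «along the
shortest geodesic in `M`», (A.22)–(A.24)); `B`, `∂B` the closed unit ball and unit sphere of `ℝⁿ`; «absolute» = chosen before
the three maps (`∃ ε_M > 0, c₁, c₂` outside `∀ f₁ f₂ f₁^e`); (A.18)–(A.19) in `ℝ≥0∞` (`supDist`, `lipConst`).  `Prop`-valued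
definition, NOT asserted. [cite: Federbush1988PhaseCellIV, Theorem A.2 (A.17)–(A.19) p. 341] -/
def ThmA2 (n : ℕ) {E : Type*} [NormedAddCommGroup E] [NormedSpace ℝ E] {H : Type*} [TopologicalSpace H]
    (I : ModelWithCorners ℝ E H) (M : Type*) [EMetricSpace M] [ChartedSpace H M] [IsManifold I ∞ M]
    [RiemannianBundle (fun (x : M) ↦ TangentSpace I x)]
    [IsContMDiffRiemannianBundle I ∞ E (fun (x : M) ↦ TangentSpace I x)]
    [IsRiemannianManifold I M] [CompactSpace M] [BoundarylessManifold I M] : Prop :=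
  ∃ εM : ℝ≥0, 0 < εM ∧ ∃ c₁ c₂ : ℝ≥0,
    ∀ (f₁ f₂ : ↥(sphere (0 : EuclideanSpace ℝ (Fin n)) 1) → M)
      (f₁e : ↥(closedBall (0 : EuclideanSpace ℝ (Fin n)) 1) → M),
      (∀ x : ↥(sphere (0 : EuclideanSpace ℝ (Fin n)) 1), f₁e ⟨x.1, sphere_subset_closedBall x.2⟩ = f₁ x) →
      supDist f₁ f₂ ≤ εM →
      ∃ f₂e : ↥(closedBall (0 : EuclideanSpace ℝ (Fin n)) 1) → M,
        (∀ x : ↥(sphere (0 : EuclideanSpace ℝ (Fin n)) 1), f₂e ⟨x.1, sphere_subset_closedBall x.2⟩ = f₂ x) ∧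
        supDist f₁e f₂e ≤ c₁ * supDist f₁ f₂ ∧
        lipConst f₂e ≤ c₂ * (lipConst f₁e + supDist f₁ f₂ + lipConst f₂)

/-! ## 6. The smoothing function (A.27)–(A.28) and the regularized distance (A.29)/(A.37) (proof of Theorems A.3/A.4, p. 342–343) -/

/-- (A.27) p. 342: «a smoothing function `w(x) ∈ C^∞`, satisfying a) `w(x) ≥ 0`, b) `∫ w(x) = 1`, c) `w(x) = 0`, `|x| ≥ 1`», on
`R^s` («where `s` is the dimension of `B`», (A.28)). [cite: Federbush1988PhaseCellIV, (A.27) p. 342] -/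
def IsSmoothingFunction (s : ℕ) (w : EuclideanSpace ℝ (Fin s) → ℝ) : Prop :=
  ContDiff ℝ ∞ w ∧ (∀ x, 0 ≤ w x) ∧ ∫ x, w x = 1 ∧ ∀ x, 1 ≤ ‖x‖ → w x = 0

/-- Such a smoothing function EXISTS (PROVED: a normalised Mathlib bump function `ContDiffBump.normed` with outer radius `1`).
[cite: Federbush1988PhaseCellIV, (A.27) p. 342] -/
theorem exists_smoothingFunction (s : ℕ) : ∃ w, IsSmoothingFunction s w := by
  let φ : ContDiffBump (0 : EuclideanSpace ℝ (Fin s)) := ⟨1/2, 1, by norm_num, by norm_num⟩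
  refine ⟨φ.normed MeasureTheory.volume, φ.contDiff_normed, fun x => φ.nonneg_normed x,
    φ.integral_normed, fun x hx => ?_⟩
  have : x ∉ Function.support (φ.normed MeasureTheory.volume) := by
    rw [φ.support_normed_eq, Metric.mem_ball, dist_zero_right, not_lt]
    exact hx
  simpa using this

/-- (A.28) p. 342: «`w^h(x) = h^{−s} w(x/h)`». [cite: Federbush1988PhaseCellIV, (A.28) p. 342] -/
def rescale (s : ℕ) (w : EuclideanSpace ℝ (Fin s) → ℝ) (h : ℝ) (x : EuclideanSpace ℝ (Fin s)) : ℝ :=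
  (h ^ s)⁻¹ * w (h⁻¹ • x)

/-- (A.29) p. 342 / (A.37) p. 343: «a function `d(x) ∈ C^∞`, `d : B → R¹`, such that `½ d(x, ∂B) ≤ d(x) ≤ d(x, ∂B)`» (resp. with
`∂B ∪ x₀`) — a regularized distance to the set `A`, smooth on `U`, comparable with `dist(·, A)` on `U`.
[cite: Federbush1988PhaseCellIV, (A.29) p. 342, (A.37) p. 343] -/
def IsRegularizedDist {n : ℕ} (A U : Set (EuclideanSpace ℝ (Fin n))) (d : EuclideanSpace ℝ (Fin n) → ℝ) : Prop :=
  ContDiffOn ℝ ∞ d U ∧ ∀ x ∈ U, (1 / 2 : ℝ) * infDist x A ≤ d x ∧ d x ≤ infDist x A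

/-! ## 7. Theorems A.3 and A.4 (Appendix A, parts C «Geometric Construction 5» and D «Geometric Construction 6», pp. 342–343) -/

/-- **Theorem A.3** p. 342, verbatim: «We consider a mapping `f` of the unit ball `B` into `M`, a compact differentiable manifold
(without boundary) equipped with a metric. *There is a mapping `f^s : B → M`, such that a) `f^s|_{∂B} = f|_{∂B}` (A.25),
b) `|D^α f^s(x)| ≤ c_α (d(x, ∂B))^{−(|α|−1)} Λ₁(f)` (A.26).*»  (Proof: «We now embed `M` in some Euclidean space `R^t`, and view
`f` as a map from `B` into `R^t`»; `f^s` = the mollification (A.30) at scale `εd(x)` followed by the normal projection onto `M`.)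
TYPING (see the module docstring): target `M ⊆ R^t` a set — print's standing hypothesis (compact differentiable submanifold
without boundary) is the hypothesis under which the `Prop` is asserted in print, not a field; `f : B → M`; `f^s` an ambient map
`ℝⁿ → R^t` with values in `M` on `B`, equal to `f` on `∂B`, `C^∞` on the open ball; (A.26) for every derivative order
`m = |α| ≥ 1` as `‖iteratedFDeriv ℝ m f^s x‖ ≤ c_m (d(x, ∂B))^{−(m−1)} K` for every Lipschitz constant `K` of `f` (⇔ the `Λ₁`
form; `f`'s distances in `M` are those of `R^t`); the `c_α` do not depend on `f`.  `Prop`-valued definition, NOT asserted.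
[cite: Federbush1988PhaseCellIV, Theorem A.3 (A.25)–(A.26) p. 342] -/
def ThmA3 (n t : ℕ) (M : Set (EuclideanSpace ℝ (Fin t))) : Prop :=
  ∃ c : ℕ → ℝ, ∀ f : ↥(closedBall (0 : EuclideanSpace ℝ (Fin n)) 1) → ↥M,
    ∃ fs : EuclideanSpace ℝ (Fin n) → EuclideanSpace ℝ (Fin t),
      MapsTo fs (closedBall 0 1) M ∧
      (∀ x : ↥(sphere (0 : EuclideanSpace ℝ (Fin n)) 1),
        fs x = (f ⟨x.1, sphere_subset_closedBall x.2⟩ : EuclideanSpace ℝ (Fin t))) ∧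
      ContDiffOn ℝ ∞ fs (ball 0 1) ∧
      ∀ m : ℕ, 1 ≤ m → ∀ K : ℝ≥0, LipschitzWith K f →
        ∀ x ∈ ball (0 : EuclideanSpace ℝ (Fin n)) 1,
          ‖iteratedFDeriv ℝ m fs x‖ ≤
            c m * ((infDist x (sphere (0 : EuclideanSpace ℝ (Fin n)) 1))⁻¹ ^ (m - 1)) * K

/-- **Theorem A.4** p. 343, verbatim (setting of part D p. 342: «We let `f` be a mapping on the boundary of the unit ball `B`,
`B = {|x − x₀| ≤ 1}` (A.32), `f : ∂B → M` (A.33), `M` a compact differentiable manifold (without boundary) equipped with a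
metric»): *«There is a mapping `f^{es}` on the ball minus its center `f^{es} : B − x₀ → M` (A.34), such that a) `f^{es}|_{∂B} =
f|_{∂B}` (A.35), b) `|D^α f^{es}| ≤ c_α (d(x, ∂B ∪ x₀))^{−(|α|−1)} · |x − x₀|^{−1} · Λ₁(f)` (A.36).»*  (Proof: the radial
mollification (A.38), «the argument of `f` remains on `∂B`».)  TYPING as for `ThmA3`: `f^{es}` an ambient map with values in
`M` on `B − x₀`, equal to `f` on `∂B`, `C^∞` on the open punctured ball, and (A.36) for every order `m = |α| ≥ 1` and every
Lipschitz constant `K` of `f`; the `c_α` independent of `f` and `x₀`.  `Prop`-valued definition, NOT asserted.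
[cite: Federbush1988PhaseCellIV, Theorem A.4 (A.34)–(A.36) p. 343] -/
def ThmA4 (n t : ℕ) (M : Set (EuclideanSpace ℝ (Fin t))) : Prop :=
  ∃ c : ℕ → ℝ, ∀ (x₀ : EuclideanSpace ℝ (Fin n)) (f : ↥(sphere x₀ 1) → ↥M),
    ∃ fes : EuclideanSpace ℝ (Fin n) → EuclideanSpace ℝ (Fin t),
      MapsTo fes (closedBall x₀ 1 \ {x₀}) M ∧
      (∀ x : ↥(sphere x₀ 1), fes x = (f x : EuclideanSpace ℝ (Fin t))) ∧
      ContDiffOn ℝ ∞ fes (ball x₀ 1 \ {x₀}) ∧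
      ∀ m : ℕ, 1 ≤ m → ∀ K : ℝ≥0, LipschitzWith K f →
        ∀ x ∈ ball x₀ 1 \ {x₀},
          ‖iteratedFDeriv ℝ m fes x‖ ≤
            c m * ((infDist x (sphere x₀ 1 ∪ {x₀}))⁻¹ ^ (m - 1)) * ‖x - x₀‖⁻¹ * K

/-! ## 8. (v1.1) The regularized distances of (A.29) and (A.37) exist — PROVED -/

/-- A unit vector of `ℝⁿ`, `n ≥ 1` (so that the unit sphere `∂B` is non-empty). [cite: Federbush1988PhaseCellIV, (A.29) p. 342] -/
theorem exists_norm_eq_one {n : ℕ} (hn : 1 ≤ n) : ∃ u : EuclideanSpace ℝ (Fin n), ‖u‖ = 1 := by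
  refine ⟨EuclideanSpace.single (⟨0, hn⟩ : Fin n) (1 : ℝ), ?_⟩
  simp

/-- `d(x, ∂B) ≤ 1 − |x − x₀|` for `x` in the closed unit ball about `x₀` (`n ≥ 1`): the radial point of `∂B` realises it.
[cite: Federbush1988PhaseCellIV, (A.29) p. 342, (A.37) p. 343] -/
theorem infDist_sphere_le {n : ℕ} (hn : 1 ≤ n) (c x : EuclideanSpace ℝ (Fin n)) (hx : ‖x - c‖ ≤ 1) :
    infDist x (sphere c 1) ≤ 1 - ‖x - c‖ := by
  by_cases h0 : x - c = 0
  · obtain ⟨u, hu⟩ := exists_norm_eq_one hn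
    have hmem : c + u ∈ sphere c 1 := by simp [hu]
    have hx0 : x = c := sub_eq_zero.mp h0
    calc infDist x (sphere c 1) ≤ dist x (c + u) := infDist_le_dist_of_mem hmem
      _ = 1 - ‖x - c‖ := by simp [hx0, dist_eq_norm, hu]
  · set r := ‖x - c‖ with hr
    have hrpos : 0 < r := norm_pos_iff.mpr h0
    let y : EuclideanSpace ℝ (Fin n) := c + r⁻¹ • (x - c)
    have hy : y ∈ sphere c 1 := by
      rw [mem_sphere, dist_eq_norm]
      simp only [y, add_sub_cancel_left, norm_smul, norm_inv, hr, norm_norm]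
      exact inv_mul_cancel₀ (norm_ne_zero_iff.mpr h0)
    calc infDist x (sphere c 1) ≤ dist x y := infDist_le_dist_of_mem hy
      _ = 1 - r := by
        have : x - y = (1 - r⁻¹) • (x - c) := by
          simp only [y]; rw [sub_smul, one_smul]; abel
        rw [dist_eq_norm, this, norm_smul, ← hr]
        have h1 : 1 - r⁻¹ ≤ 0 := by
          have : 1 ≤ r⁻¹ := one_le_inv_iff₀.mpr ⟨hrpos, hx⟩
          linarith
        rw [Real.norm_eq_abs, abs_of_nonpos h1]
        field_simp
        ring

/-- `1 − |x − x₀| ≤ d(x, ∂B)` for every `x` (`n ≥ 1`), by the reverse triangle inequality.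
[cite: Federbush1988PhaseCellIV, (A.29) p. 342, (A.37) p. 343] -/
theorem le_infDist_sphere {n : ℕ} (hn : 1 ≤ n) (c x : EuclideanSpace ℝ (Fin n)) :
    1 - ‖x - c‖ ≤ infDist x (sphere c 1) := by
  obtain ⟨u, hu⟩ := exists_norm_eq_one hn
  have hne : (sphere c (1 : ℝ)).Nonempty := ⟨c + u, by simp [hu]⟩
  refine (le_infDist hne).mpr fun y hy => ?_
  rw [mem_sphere, dist_eq_norm] at hy
  rw [dist_comm, dist_eq_norm]
  have := norm_sub_norm_le (y - c) (x - c)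
  rw [show y - c - (x - c) = y - x by abel, hy] at this
  exact this

/-- (A.29) p. 342: «a function `d(x) ∈ C^∞`, `d : B → R¹`, such that `½ d(x, ∂B) ≤ d(x) ≤ d(x, ∂B)`» EXISTS on the open unit ball
of `ℝⁿ`, `n ≥ 1` — PROVED with the explicit `d(x) = ½(1 − |x|²)` (a polynomial, hence `C^∞`; `d(x, ∂B) = 1 − |x|` and
`½(1 − |x|) ≤ ½(1 − |x|)(1 + |x|) ≤ 1 − |x|`). [cite: Federbush1988PhaseCellIV, (A.29) p. 342] -/
theorem exists_regularizedDist_ball {n : ℕ} (hn : 1 ≤ n) :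
    ∃ d, IsRegularizedDist (sphere (0 : EuclideanSpace ℝ (Fin n)) 1) (ball 0 1) d := by
  refine ⟨fun x => (1 - ‖x‖ ^ 2) / 2, ?_, fun x hx => ?_⟩
  · apply ContDiff.contDiffOn
    have : ContDiff ℝ ∞ fun x : EuclideanSpace ℝ (Fin n) => ‖x‖ ^ 2 := contDiff_norm_sq ℝ
    exact (contDiff_const.sub this).div_const _
  · have hx1 : ‖x‖ < 1 := by simpa using hx
    have h0 : 0 ≤ ‖x‖ := norm_nonneg _
    have hle := infDist_sphere_le hn 0 x (by simpa using hx1.le)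
    have hge := le_infDist_sphere hn 0 x
    simp only [sub_zero] at hle hge
    constructor <;> nlinarith

/-- (A.37) p. 343: «`d′ ∈ C^∞`, `d′ : B → R¹`, such that `½ d(x, ∂B ∪ x₀) ≤ d′(x) ≤ d(x, ∂B ∪ x₀)`» EXISTS on the punctured open unit
ball `B − x₀` — PROVED with the explicit `d′(x) = |x − x₀|(1 − |x − x₀|)` (`C^∞` away from `x₀`; with `r = |x − x₀|`,
`d(x, ∂B ∪ x₀) = min(r, 1 − r)` and `½ min(r, 1 − r) ≤ r(1 − r) ≤ min(r, 1 − r)` on `0 < r < 1`).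
[cite: Federbush1988PhaseCellIV, (A.37) p. 343] -/
theorem exists_regularizedDist_puncturedBall {n : ℕ} (hn : 1 ≤ n) (x₀ : EuclideanSpace ℝ (Fin n)) :
    ∃ d, IsRegularizedDist (sphere x₀ 1 ∪ {x₀}) (ball x₀ 1 \ {x₀}) d := by
  refine ⟨fun x => ‖x - x₀‖ * (1 - ‖x - x₀‖), ?_, fun x hx => ?_⟩
  · intro x hx
    have hx0 : x - x₀ ≠ 0 := sub_ne_zero.mpr (by simpa using hx.2)
    have h1 : ContDiffAt ℝ ∞ (fun x : EuclideanSpace ℝ (Fin n) => ‖x - x₀‖) x :=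
      (contDiffAt_norm ℝ hx0).comp x (contDiffAt_id.sub contDiffAt_const)
    exact (h1.mul (contDiffAt_const.sub h1)).contDiffWithinAt
  · have hr1 : ‖x - x₀‖ < 1 := by simpa [dist_eq_norm] using hx.1
    have hne0 : x - x₀ ≠ 0 := sub_ne_zero.mpr (by simpa using hx.2)
    have hr0 : 0 < ‖x - x₀‖ := norm_pos_iff.mpr hne0
    obtain ⟨u, hu⟩ := exists_norm_eq_one hn
    have hSne : (sphere x₀ (1 : ℝ)).Nonempty := ⟨x₀ + u, by simp [hu]⟩
    have hA : infDist x (sphere x₀ 1 ∪ {x₀}) ≤ 1 - ‖x - x₀‖ :=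
      (infDist_le_infDist_of_subset subset_union_left hSne).trans (infDist_sphere_le hn x₀ x hr1.le)
    have hB : infDist x (sphere x₀ 1 ∪ {x₀}) ≤ ‖x - x₀‖ := by
      have := infDist_le_dist_of_mem (x := x) (show x₀ ∈ sphere x₀ 1 ∪ {x₀} from Or.inr rfl)
      simpa [dist_eq_norm] using this
    have hC : ‖x - x₀‖ * (1 - ‖x - x₀‖) ≤ infDist x (sphere x₀ 1 ∪ {x₀}) := by
      refine (le_infDist (hSne.mono subset_union_left)).mpr fun y hy => ?_
      rcases hy with hy | hy
      · have h1 := (le_infDist hSne).mp (le_infDist_sphere hn x₀ x) hy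
        nlinarith [norm_nonneg (x - x₀)]
      · rw [mem_singleton_iff] at hy
        rw [hy, dist_eq_norm]
        nlinarith [norm_nonneg (x - x₀)]
    refine ⟨?_, hC⟩
    rcases le_total ‖x - x₀‖ (1 / 2) with h | h
    · nlinarith
    · nlinarith

end PhaseCellIVAppA

end

end Literature.MathematicalPhysics.QuantumFieldTheory.Federbush1986
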